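import Summits.QuantumFields.YangMills.Theorems.BrascampLiebVacuum.Negative.WilsonTorusToolkit
import Literature.MathematicalPhysics.QuantumLattice.HeatKernelGroupMeasureProofs

/-!
# `ConvexGribovBody.BrascampLiebVacuum` — negative lemma: the Lipschitz hypothesis is
load-bearing (refuter, crux stmt-QuantumFields-8779)

Hypothesis (iii) of `Summit.QuantumFields.YangMills.Theses.ConvexGribovBody.BrascampLiebVacuum`
asks the test function `f` to be Lipschitz in the link matrices,
`|f U - f V| ≤ K Σₑ √fro(ρ(Uₑ) − ρ(Vₑ))`. It is what makes the crux's metric slope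
`slope f U e = limsup_{g → U e} |f(U[e ↦ g]) − f U| / √fro(ρ g − ρ(U e))` a GENUINE quantity
(bounded by `K`). Without it the statement is false at every admissible `(G, r)`:

* the witness is the indicator `f = 1_A` of `A = {Re tr ρ(U_p) < c}`, `p` the `(1,2)`-plaquette at
  the origin of the time-zero slice, `c` strictly between `Re tr ρ(a)` and `N` for some `a` with
  `Re tr ρ(a) < N` — gauge invariant, a function of four time-zero spatial links, bounded,
  `{0,1}`-valued;
* EVERY slope of `f` vanishes (`slope_indicator_eq_zero`): where `f` is eventually constant along
  the link the difference quotient is eventually `0`; at the jump set the quotient `1/‖ρ g − ρ(U e)‖`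
  is unbounded near `U e`, the set `{a | ∀ᶠ g, quotient ≤ a}` is empty and `limsup = sInf ∅ = 0` is
  Lean's junk value — so `dir f = 0`;
* `Var_μ f ≥ (μ A)² · μ{Re tr ρ(U_p) > c} > 0` because Wilson's measure charges the two disjoint
  non-empty open sets (`isOpenPosMeasure_wilsonMeasure`).

Results: `brascampLiebVacuum_false_without_lipschitz_at` (every admissible `(G,r)`, `C`, `β`,
`S ≥ 1`), `brascampLiebVacuum_false_without_lipschitz` (the `∃ C ∃ β₀ ∀ β ∃ S₀ ∀ S` packaging fails
at every admissible `(G, r)`), `not_brascampLiebVacuum_without_lipschitz` (the crux with (iii)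
deleted, verbatim otherwise, is false — modulo the tree fact `isSimpleCompactGroup_specialUnitaryGroup`
used only to exhibit `SU(2)`). Moral for provers: any proof must use (iii) quantitatively (it is the
only source of an upper bound on the slopes, and of their non-junk meaning).
Self-contained on top of the toolkit (the plaquette-trace facts are inlined as `have`s; named
versions live in `Negative/FalseWithoutLocality.lean`).
-/

noncomputable section

open scoped BigOperators Topology Matrix Matrix.Norms.Frobenius
open Filter MeasureTheory
open Literature.MathematicalPhysics.QuantumFieldTheory

namespace Summit.QuantumFields.YangMills.Theorems.BrascampLiebVacuum.Negative

section Lipschitz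

variable {G : Type*} [Group G] [TopologicalSpace G] [IsTopologicalGroup G] [CompactSpace G]
  [MeasurableSpace G] [BorelSpace G]

omit [MeasurableSpace G] [BorelSpace G] [IsTopologicalGroup G] [CompactSpace G]
  [TopologicalSpace G] in
/-- The `(1,2)`-plaquette at the origin is a function of time-zero spatial links only. [folklore] -/
theorem plaquetteHolonomy_origin_eq_of_agree {S : ℕ} (U V : GaugeConfig 4 (2 * S + 1) G)
    (h : ∀ e : Edge 4 (2 * S + 1), e.1 0 = 0 → e.2 ≠ 0 → U e = V e) :
    plaquetteHolonomy U 0 1 2 = plaquetteHolonomy V 0 1 2 := by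
  unfold plaquetteHolonomy
  have h10 : (1 : Fin 4) ≠ 0 := by decide
  have h20 : (2 : Fin 4) ≠ 0 := by decide
  rw [h (0, 1) rfl h10, h (Site.shift 0 1, 2) (by simp [Site.shift]) h20,
    h (Site.shift 0 2, 1) (by simp [Site.shift]) h10, h (0, 2) rfl h20]

omit [MeasurableSpace G] [BorelSpace G] [IsTopologicalGroup G] [CompactSpace G] in
/-- **Every metric slope of a `{0,1}`-valued function vanishes in Lean's conventions.** Along any
link, either the function is eventually constant (quotient eventually `0`) or the quotient
`1 / ‖ρ g − ρ(U e)‖_F` is unbounded near `U e`, the defining set of the `limsup` is empty and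
`sInf ∅ = 0`. (`ρ` injective and continuous; no measure theory involved.) [folklore] -/
theorem slope_indicator_eq_zero (r : LatticeRep G) {d L : ℕ} (A : Set (GaugeConfig d L G))
    (U : GaugeConfig d L G) (e : Edge d L) :
    Filter.limsup (fun g : G => |A.indicator (fun _ => (1 : ℝ)) (Function.update U e g) -
        A.indicator (fun _ => (1 : ℝ)) U| /
      Real.sqrt (∑ a, ∑ b, ‖(r.ρ g - r.ρ (U e)) a b‖ ^ 2)) (𝓝[≠] (U e)) = 0 := by
  simp_rw [sqrt_sum_sq_eq_norm]
  set q := fun g : G => |A.indicator (fun _ => (1 : ℝ)) (Function.update U e g) -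
      A.indicator (fun _ => (1 : ℝ)) U| / ‖r.ρ g - r.ρ (U e)‖ with hq
  by_cases hev : ∀ᶠ g in 𝓝[≠] (U e),
      A.indicator (fun _ => (1 : ℝ)) (Function.update U e g) = A.indicator (fun _ => (1 : ℝ)) U
  · have : q =ᶠ[𝓝[≠] (U e)] fun _ => 0 :=
      hev.mono fun g hg => by simp only [hq, hg, sub_self, abs_zero, zero_div]
    rw [Filter.limsup_congr this]
    exact limsup_const_zero _
  · rw [Filter.limsup_eq]
    suffices hempty : {a : ℝ | ∀ᶠ n in 𝓝[≠] (U e), q n ≤ a} = ∅ by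
      rw [hempty]; exact Real.sInf_empty
    refine Set.eq_empty_iff_forall_notMem.2 fun b hb => ?_
    rw [Set.mem_setOf_eq] at hb
    have hfr : ∃ᶠ g in 𝓝[≠] (U e), A.indicator (fun _ => (1 : ℝ)) (Function.update U e g) ≠
        A.indicator (fun _ => (1 : ℝ)) U := Filter.not_eventually.1 hev
    have hcont : Continuous fun g : G => ‖r.ρ g - r.ρ (U e)‖ :=
      (r.continuous.sub continuous_const).norm
    have h0 : ‖r.ρ (U e) - r.ρ (U e)‖ < 1 / (|b| + 1) := by
      rw [sub_self, norm_zero]; positivity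
    have hsmall : ∀ᶠ g in 𝓝[≠] (U e), ‖r.ρ g - r.ρ (U e)‖ < 1 / (|b| + 1) :=
      nhdsWithin_le_nhds ((hcont.tendsto (U e)).eventually (gt_mem_nhds h0))
    have hpos : ∀ᶠ g in 𝓝[≠] (U e), 0 < ‖r.ρ g - r.ρ (U e)‖ := by
      refine eventually_nhdsWithin_of_forall fun g hg => norm_pos_iff.2 (sub_ne_zero.2 ?_)
      exact fun h => hg (r.injective h)
    have hev3 : ∀ᶠ g in 𝓝[≠] (U e), q g ≤ b ∧ ‖r.ρ g - r.ρ (U e)‖ < 1 / (|b| + 1) ∧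
        0 < ‖r.ρ g - r.ρ (U e)‖ := hb.and (hsmall.and hpos)
    obtain ⟨g, hne, hqb, hgs, hgp⟩ := (hfr.and_eventually hev3).exists
    have habs : |A.indicator (fun _ => (1 : ℝ)) (Function.update U e g) -
        A.indicator (fun _ => (1 : ℝ)) U| = 1 := by
      by_cases h1 : Function.update U e g ∈ A <;> by_cases h2 : U ∈ A <;>
        simp [Set.indicator_of_mem, Set.indicator_of_notMem, h1, h2] at hne ⊢
    have hqg : q g = 1 / ‖r.ρ g - r.ρ (U e)‖ := by simp only [hq, habs]
    have h1 : |b| + 1 < 1 / ‖r.ρ g - r.ρ (U e)‖ := by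
      have := one_div_lt_one_div_of_lt hgp hgs
      rwa [one_div_one_div] at this
    have h2 : q g ≤ b := hqb
    rw [hqg] at h2
    linarith [le_abs_self b]

/-- **Hypothesis (iii) of the crux is load-bearing, for EVERY admissible `(G, r)`, every `C`,
every coupling `β` and every torus `S ≥ 1`**: the indicator of `{Re tr ρ(U_p) < c}` (`p` the
time-zero plaquette at the origin, `c` between `Re tr ρ(a)` and `N`) is gauge invariant and a
function of the time-zero spatial links, has `dir f = 0` (all slopes vanish,
`slope_indicator_eq_zero`) and positive variance. Hence `C · Dmax · dir f = 0 < Var_μ f`. [folklore] -/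
theorem brascampLiebVacuum_false_without_lipschitz_at (hG : IsCompactSimpleLieGroup G) {S : ℕ}
    (hS : 1 ≤ S) (r : LatticeRep G) (C β : ℝ) :
    let μ := wilsonMeasure (d := 4) (L := 2 * S + 1) r.ρ β
    let fro : Matrix (Fin r.N) (Fin r.N) ℂ → ℝ := fun M => ∑ a, ∑ b, ‖M a b‖ ^ 2
    let coul : GaugeConfig 4 (2 * S + 1) G → (Site 4 (2 * S + 1) → G) → ℝ := fun U h =>
      -∑ e : Edge 4 (2 * S + 1),
        (if e.1 0 = 0 ∧ e.2 ≠ 0 then (r.ρ (gaugeTransform h U e)).trace.re else 0)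
    let cov : GaugeConfig 4 (2 * S + 1) G → (Site 4 (2 * S + 1) → G) →
        (Fin 3 → ZMod (2 * S + 1)) → ℝ := fun U h p =>
      (∑ j : Fin 3, fro (∑ y : Fin 3 → ZMod (2 * S + 1),
        Complex.exp (-(2 * Real.pi * Complex.I *
          (∑ i : Fin 3, ((p i).val : ℂ) * ((y i).val : ℂ)) / (2 * S + 1 : ℂ))) •
        ((1 / 2 : ℂ) • (r.ρ (gaugeTransform h U (Fin.cons (0 : ZMod (2 * S + 1)) y, j.succ)) -
          (r.ρ (gaugeTransform h U (Fin.cons (0 : ZMod (2 * S + 1)) y, j.succ)))ᴴ)))) /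
        ((2 * S + 1 : ℝ) ^ 3)
    let Dmax : ℝ := ⨆ p : Fin 3 → ZMod (2 * S + 1),
      ∫ U, (⨆ h : {h : Site 4 (2 * S + 1) → G // ∀ h', coul U h ≤ coul U h'}, cov U h.1 p) ∂μ
    let slope : (GaugeConfig 4 (2 * S + 1) G → ℝ) → GaugeConfig 4 (2 * S + 1) G →
        Edge 4 (2 * S + 1) → ℝ := fun f U e =>
      Filter.limsup (fun g : G => |f (Function.update U e g) - f U| /
        Real.sqrt (fro (r.ρ g - r.ρ (U e)))) (𝓝[≠] (U e))
    let dir : (GaugeConfig 4 (2 * S + 1) G → ℝ) → ℝ := fun f =>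
      ∑ e : Edge 4 (2 * S + 1), (if e.1 0 = 0 ∧ e.2 ≠ 0 then ∫ U, (slope f U e) ^ 2 ∂μ else 0)
    ∃ f : GaugeConfig 4 (2 * S + 1) G → ℝ, IsGaugeInvariant f ∧
      (∀ U V : GaugeConfig 4 (2 * S + 1) G,
        (∀ e : Edge 4 (2 * S + 1), e.1 0 = 0 → e.2 ≠ 0 → U e = V e) → f U = f V) ∧
      (∀ U, f U = 0 ∨ f U = 1) ∧
      dir f = 0 ∧ C * Dmax * dir f < ∫ U, (f U - ∫ V, f V ∂μ) ^ 2 ∂μ := by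
  intro μ fro coul cov Dmax slope dir
  haveI : Fact (1 < 2 * S + 1) := ⟨by omega⟩
  -- some `a` with `Re tr ρ(a) < N` (`G` non-abelian, `ρ` faithful unitary)
  obtain ⟨a, ha⟩ : ∃ a : G, (r.ρ a).trace.re < r.N := by
    have hG' := hG.1
    unfold Literature.MathematicalPhysics.QuantumLattice.IsSimpleCompactGroup at hG'
    obtain ⟨-, ⟨a, b, hab⟩, -⟩ := hG'
    have ha1 : a ≠ 1 := fun ha => hab (by rw [ha, one_mul, mul_one])
    have hρa : r.ρ a ≠ 1 := fun h => ha1 (r.injective (by rw [h, map_one]))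
    exact ⟨a, re_trace_lt_of_ne_one (r.mem_unitary a) hρa⟩
  -- the time-zero plaquette trace at the origin: invariance, locality, values (inlined)
  have hGI : IsGaugeInvariant (fun U : GaugeConfig 4 (2 * S + 1) G => (r.ρ (plaquetteHolonomy U 0 1 2)).trace.re) := fun h U => by
    beta_reduce
    rw [Literature.MathematicalPhysics.QuantumLattice.plaquetteHolonomy_gaugeTransform, map_mul,
      map_mul, Matrix.trace_mul_cycle, ← map_mul, inv_mul_cancel, map_one, one_mul]
  have h10 : (1 : Fin 4) ≠ 0 := by decide
  have h20 : (2 : Fin 4) ≠ 0 := by decide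
  have hloc : ∀ U V : GaugeConfig 4 (2 * S + 1) G,
      (∀ e : Edge 4 (2 * S + 1), e.1 0 = 0 → e.2 ≠ 0 → U e = V e) →
      plaquetteHolonomy U 0 1 2 = plaquetteHolonomy V 0 1 2 := fun U V h => by
    unfold plaquetteHolonomy
    rw [h (0, 1) rfl h10, h (Site.shift 0 1, 2) (by simp [Site.shift]) h20,
      h (Site.shift 0 2, 1) (by simp [Site.shift]) h10, h (0, 2) rfl h20]
  have hupd : ∀ a : G, plaquetteHolonomy
      (Function.update (1 : GaugeConfig 4 (2 * S + 1) G) ((0 : Site 4 (2 * S + 1)), 1) a) 0 1 2 = a := by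
    intro a
    have h3 : ((Site.shift (0 : Site 4 (2 * S + 1)) 2, (1 : Fin 4)) : Edge 4 (2 * S + 1)) ≠ (0, 1) := by
      intro h
      have := congrArg (fun e : Edge 4 (2 * S + 1) => e.1 2) h
      simp [Site.shift] at this
    simp [plaquetteHolonomy, Function.update_of_ne h3]
  have hcont : Continuous (fun U : GaugeConfig 4 (2 * S + 1) G => (r.ρ (plaquetteHolonomy U 0 1 2)).trace.re) :=
    Complex.continuous_re.comp (Continuous.matrix_trace (r.continuous.comp
      (Literature.MathematicalPhysics.QuantumLattice.continuous_plaquetteHolonomy 0 1 2)))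
  set c : ℝ := ((r.ρ a).trace.re + r.N) / 2 with hc
  set g₀ : GaugeConfig 4 (2 * S + 1) G → ℝ :=
    fun U => (r.ρ (plaquetteHolonomy U 0 1 2)).trace.re with hg₀
  set A : Set (GaugeConfig 4 (2 * S + 1) G) := {U | g₀ U < c} with hA
  refine ⟨A.indicator (fun _ => (1 : ℝ)), ?_, ?_, ?_, ?_⟩
  · intro h U
    have hinv := hGI h U
    beta_reduce at hinv
    have hmem : gaugeTransform h U ∈ A ↔ U ∈ A := by
      simp only [hA, Set.mem_setOf_eq]
      rw [hinv]
    by_cases hU : U ∈ A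
    · rw [Set.indicator_of_mem hU, Set.indicator_of_mem (hmem.2 hU)]
    · rw [Set.indicator_of_notMem hU, Set.indicator_of_notMem (mt hmem.1 hU)]
  · intro U V hUV
    have hmem : U ∈ A ↔ V ∈ A := by
      simp only [hA, Set.mem_setOf_eq, hg₀]
      rw [hloc U V hUV]
    by_cases hU : U ∈ A
    · rw [Set.indicator_of_mem hU, Set.indicator_of_mem (hmem.1 hU)]
    · rw [Set.indicator_of_notMem hU, Set.indicator_of_notMem (mt hmem.2 hU)]
  · intro U
    by_cases hU : U ∈ A
    · exact Or.inr (Set.indicator_of_mem hU _)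
    · exact Or.inl (Set.indicator_of_notMem hU _)
  have hdir : dir (A.indicator fun _ => (1 : ℝ)) = 0 := by
    show (∑ e : Edge 4 (2 * S + 1), (if e.1 0 = 0 ∧ e.2 ≠ 0 then
      ∫ U, (slope (A.indicator fun _ => (1 : ℝ)) U e) ^ 2 ∂μ else 0)) = 0
    refine Finset.sum_eq_zero fun e _ => ?_
    split_ifs with he
    · have : ∀ U, slope (A.indicator fun _ => (1 : ℝ)) U e = 0 := fun U =>
        slope_indicator_eq_zero r A U e
      simp [this]
    · rfl
  refine ⟨hdir, ?_⟩
  rw [hdir, mul_zero]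
  -- positivity of the variance
  haveI : SecondCountableTopology G :=
    (r.continuous.isClosedEmbedding r.injective).isEmbedding.secondCountableTopology
  haveI := isOpenPosMeasure_wilsonMeasure (d := 4) (L := 2 * S + 1) r.ρ r.continuous β
  haveI := isProbabilityMeasure_wilsonMeasure (d := 4) (L := 2 * S + 1) r.ρ r.continuous β
  have hg₀c : Continuous g₀ := hcont
  have hAo : IsOpen A := isOpen_lt hg₀c continuous_const
  set B : Set (GaugeConfig 4 (2 * S + 1) G) := {U | c < g₀ U} with hB
  have hBo : IsOpen B := isOpen_lt continuous_const hg₀c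
  have hcN : c < r.N := by rw [hc]; linarith
  have hca : (r.ρ a).trace.re < c := by rw [hc]; linarith
  have hBne : B.Nonempty := ⟨1, by
    simp only [hB, Set.mem_setOf_eq, hg₀, Literature.MathematicalPhysics.QuantumLattice.plaquetteHolonomy_one,
      map_one, Matrix.trace_one, Fintype.card_fin, Complex.natCast_re]
    exact hcN⟩
  have hAne : A.Nonempty := ⟨Function.update (1 : GaugeConfig 4 (2 * S + 1) G) ((0 : Site 4 (2 * S + 1)), 1) a, by
    simp only [hA, Set.mem_setOf_eq, hg₀]
    rw [hupd a]
    exact hca⟩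
  have hAm : MeasurableSet A := hAo.measurableSet
  have hBm : MeasurableSet B := hBo.measurableSet
  set m : ℝ := ∫ V, A.indicator (fun _ => (1 : ℝ)) V ∂μ with hm
  have hmA : m = μ.real A := by
    rw [hm, integral_indicator_const _ hAm, smul_eq_mul, mul_one]
  have hmpos : 0 < m := by
    rw [hmA, measureReal_def]
    exact ENNReal.toReal_pos (hAo.measure_pos μ hAne).ne' (measure_ne_top μ A)
  have hBpos : 0 < μ.real B := by
    rw [measureReal_def]
    exact ENNReal.toReal_pos (hBo.measure_pos μ hBne).ne' (measure_ne_top μ B)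
  -- pointwise lower bound `m² · 1_B ≤ (f - m)²` (on `B`, `f = 0`)
  have hAB : ∀ U ∈ B, U ∉ A := fun U hUB hUA => by
    simp only [hA, hB, Set.mem_setOf_eq] at hUA hUB
    linarith
  have hpt : ∀ U, B.indicator (fun _ => m ^ 2) U ≤
      (A.indicator (fun _ => (1 : ℝ)) U - m) ^ 2 := fun U => by
    by_cases hUB : U ∈ B
    · rw [Set.indicator_of_mem hUB, Set.indicator_of_notMem (hAB U hUB)]
      ring_nf
      exact le_rfl
    · rw [Set.indicator_of_notMem hUB]
      exact sq_nonneg _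
  have hint1 : Integrable (B.indicator fun _ => m ^ 2) μ := (integrable_const _).indicator hBm
  have hfint : Integrable (A.indicator fun _ => (1 : ℝ)) μ := (integrable_const _).indicator hAm
  have hint2 : Integrable (fun U => (A.indicator (fun _ => (1 : ℝ)) U - m) ^ 2) μ := by
    refine Integrable.mono' (integrable_const ((1 + |m|) ^ 2))
      ((hfint.sub (integrable_const m)).aestronglyMeasurable.pow 2) (Eventually.of_forall fun U => ?_)
    rw [Real.norm_eq_abs, abs_pow]
    have h1 : |A.indicator (fun _ => (1 : ℝ)) U| ≤ 1 := by
      by_cases hU : U ∈ A <;> simp [Set.indicator_of_mem, Set.indicator_of_notMem, hU]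
    have h2 : |A.indicator (fun _ => (1 : ℝ)) U - m| ≤ 1 + |m| :=
      (abs_sub _ _).trans (by linarith)
    exact pow_le_pow_left₀ (abs_nonneg _) h2 2
  calc (0 : ℝ) < μ.real B * m ^ 2 := by positivity
    _ = ∫ U, B.indicator (fun _ => m ^ 2) U ∂μ := by
        rw [integral_indicator_const _ hBm, smul_eq_mul]
    _ ≤ ∫ U, (A.indicator (fun _ => (1 : ℝ)) U - m) ^ 2 ∂μ := integral_mono hint1 hint2 hpt

/-- **`BrascampLiebVacuum` without (iii) fails at every admissible `(G, r)`** (any `C > 0`, `β₀`,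
`S₀(β)`: take `β = β₀`, `S = max S₀ 1` and the indicator witness). [folklore] -/
theorem brascampLiebVacuum_false_without_lipschitz (hG : IsCompactSimpleLieGroup G)
    (r : LatticeRep G) :
    ¬ (∃ C : ℝ, 0 < C ∧ ∃ β₀ : ℝ, ∀ β : ℝ, β₀ ≤ β → ∃ S₀ : ℕ, ∀ S : ℕ, S₀ ≤ S →
    let μ := wilsonMeasure (d := 4) (L := 2 * S + 1) r.ρ β
    let fro : Matrix (Fin r.N) (Fin r.N) ℂ → ℝ := fun M => ∑ a, ∑ b, ‖M a b‖ ^ 2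
    let coul : GaugeConfig 4 (2 * S + 1) G → (Site 4 (2 * S + 1) → G) → ℝ := fun U h =>
      -∑ e : Edge 4 (2 * S + 1),
        (if e.1 0 = 0 ∧ e.2 ≠ 0 then (r.ρ (gaugeTransform h U e)).trace.re else 0)
    let cov : GaugeConfig 4 (2 * S + 1) G → (Site 4 (2 * S + 1) → G) →
        (Fin 3 → ZMod (2 * S + 1)) → ℝ := fun U h p =>
      (∑ j : Fin 3, fro (∑ y : Fin 3 → ZMod (2 * S + 1),
        Complex.exp (-(2 * Real.pi * Complex.I *
          (∑ i : Fin 3, ((p i).val : ℂ) * ((y i).val : ℂ)) / (2 * S + 1 : ℂ))) •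
        ((1 / 2 : ℂ) • (r.ρ (gaugeTransform h U (Fin.cons (0 : ZMod (2 * S + 1)) y, j.succ)) -
          (r.ρ (gaugeTransform h U (Fin.cons (0 : ZMod (2 * S + 1)) y, j.succ)))ᴴ)))) /
        ((2 * S + 1 : ℝ) ^ 3)
    let Dmax : ℝ := ⨆ p : Fin 3 → ZMod (2 * S + 1),
      ∫ U, (⨆ h : {h : Site 4 (2 * S + 1) → G // ∀ h', coul U h ≤ coul U h'}, cov U h.1 p) ∂μ
    let slope : (GaugeConfig 4 (2 * S + 1) G → ℝ) → GaugeConfig 4 (2 * S + 1) G →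
        Edge 4 (2 * S + 1) → ℝ := fun f U e =>
      Filter.limsup (fun g : G => |f (Function.update U e g) - f U| /
        Real.sqrt (fro (r.ρ g - r.ρ (U e)))) (𝓝[≠] (U e))
    let dir : (GaugeConfig 4 (2 * S + 1) G → ℝ) → ℝ := fun f =>
      ∑ e : Edge 4 (2 * S + 1), (if e.1 0 = 0 ∧ e.2 ≠ 0 then ∫ U, (slope f U e) ^ 2 ∂μ else 0)
    ∀ f : GaugeConfig 4 (2 * S + 1) G → ℝ, IsGaugeInvariant f →
      (∀ U V : GaugeConfig 4 (2 * S + 1) G,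
        (∀ e : Edge 4 (2 * S + 1), e.1 0 = 0 → e.2 ≠ 0 → U e = V e) → f U = f V) →
      ∫ U, (f U - ∫ V, f V ∂μ) ^ 2 ∂μ ≤ C * Dmax * dir f) := by
  rintro ⟨C, -, β₀, h⟩
  obtain ⟨S₀, hS₀⟩ := h β₀ le_rfl
  have h1 := hS₀ (max S₀ 1) (le_max_left _ _)
  obtain ⟨f, hf₁, hf₂, -, -, hlt⟩ := brascampLiebVacuum_false_without_lipschitz_at hG
    (S := max S₀ 1) (le_max_right _ _) r C β₀
  exact absurd (h1 f hf₁ hf₂) (not_le.2 hlt)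

/-- **The crux with hypothesis (iii) deleted is false** — `ConvexGribovBody.BrascampLiebVacuum`
with the Lipschitz clause `(∃ K, ∀ U V, |f U - f V| ≤ K * Σₑ √fro(ρ(U e) − ρ(V e)))` removed and
everything else verbatim; modulo the tree's named fact `isSimpleCompactGroup_specialUnitaryGroup`,
used only to exhibit one admissible group (`SU(2)`, fundamental `r`); the failure itself is
unconditional at every admissible `(G, r)` (`brascampLiebVacuum_false_without_lipschitz`). [folklore] -/
theorem not_brascampLiebVacuum_without_lipschitz
    (h : Literature.MathematicalPhysics.QuantumLattice.isSimpleCompactGroup_specialUnitaryGroup.{0}) :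
    ¬ (∀ (G : Type) [Group G] [TopologicalSpace G] [IsTopologicalGroup G] [CompactSpace G]
      [MeasurableSpace G] [BorelSpace G], IsCompactSimpleLieGroup G → ∀ r : LatticeRep G,
      ∃ C : ℝ, 0 < C ∧ ∃ β₀ : ℝ, ∀ β : ℝ, β₀ ≤ β → ∃ S₀ : ℕ, ∀ S : ℕ, S₀ ≤ S →
      let μ := wilsonMeasure (d := 4) (L := 2 * S + 1) r.ρ β
      let fro : Matrix (Fin r.N) (Fin r.N) ℂ → ℝ := fun M => ∑ a, ∑ b, ‖M a b‖ ^ 2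
      let coul : GaugeConfig 4 (2 * S + 1) G → (Site 4 (2 * S + 1) → G) → ℝ := fun U h =>
        -∑ e : Edge 4 (2 * S + 1),
          (if e.1 0 = 0 ∧ e.2 ≠ 0 then (r.ρ (gaugeTransform h U e)).trace.re else 0)
      let cov : GaugeConfig 4 (2 * S + 1) G → (Site 4 (2 * S + 1) → G) →
          (Fin 3 → ZMod (2 * S + 1)) → ℝ := fun U h p =>
        (∑ j : Fin 3, fro (∑ y : Fin 3 → ZMod (2 * S + 1),
          Complex.exp (-(2 * Real.pi * Complex.I *
            (∑ i : Fin 3, ((p i).val : ℂ) * ((y i).val : ℂ)) / (2 * S + 1 : ℂ))) •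
          ((1 / 2 : ℂ) • (r.ρ (gaugeTransform h U (Fin.cons (0 : ZMod (2 * S + 1)) y, j.succ)) -
            (r.ρ (gaugeTransform h U (Fin.cons (0 : ZMod (2 * S + 1)) y, j.succ)))ᴴ)))) /
          ((2 * S + 1 : ℝ) ^ 3)
      let Dmax : ℝ := ⨆ p : Fin 3 → ZMod (2 * S + 1),
        ∫ U, (⨆ h : {h : Site 4 (2 * S + 1) → G // ∀ h', coul U h ≤ coul U h'}, cov U h.1 p) ∂μ
      let slope : (GaugeConfig 4 (2 * S + 1) G → ℝ) → GaugeConfig 4 (2 * S + 1) G →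
          Edge 4 (2 * S + 1) → ℝ := fun f U e =>
        Filter.limsup (fun g : G => |f (Function.update U e g) - f U| /
          Real.sqrt (fro (r.ρ g - r.ρ (U e)))) (𝓝[≠] (U e))
      let dir : (GaugeConfig 4 (2 * S + 1) G → ℝ) → ℝ := fun f =>
        ∑ e : Edge 4 (2 * S + 1), (if e.1 0 = 0 ∧ e.2 ≠ 0 then ∫ U, (slope f U e) ^ 2 ∂μ else 0)
      ∀ f : GaugeConfig 4 (2 * S + 1) G → ℝ, IsGaugeInvariant f →
        (∀ U V : GaugeConfig 4 (2 * S + 1) G,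
          (∀ e : Edge 4 (2 * S + 1), e.1 0 = 0 → e.2 ≠ 0 → U e = V e) → f U = f V) →
        ∫ U, (f U - ∫ V, f V ∂μ) ^ 2 ∂μ ≤ C * Dmax * dir f) := by
  intro hBL
  have hSU := isCompactSimpleLieGroup_specialUnitaryGroup h (le_refl 2)
  obtain ⟨r⟩ := hSU.2
  exact brascampLiebVacuum_false_without_lipschitz hSU r (hBL _ hSU r)

end Lipschitz

end Summit.QuantumFields.YangMills.Theorems.BrascampLiebVacuum.Negative

end
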